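import Literature.NumberTheory.NumberFields.ClassGroupExtension
import Literature.NumberTheory.NumberFields.AmbiguousIdeals
import Mathlib.NumberTheory.NumberField.CMField
import HarnessLib

/-!
# A quadratic CM layer `L/M`: the unit `σα/α` of a capitulating ideal is REAL, and Hilbert 90 has a real integral solution
# (first half of «no capitulation in a quadratic CM layer»; Ferrero 1980 §3 / Kida 1979 bookkeeping; proved)

Topic `NumberTheory/NumberFields` (namespace = path, sub-namespace `CMLayer`).  THEOREM-ONLY file (no definition, no named fact, no instance, no `sorry`),
written by the prover seat `bsd-line-att-p3` g31 (cell `bsd-f1-sign2`; `--supports` stmt-BirchSwinnertonDyer-22298; closes nothing).  Sequel: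
`CMFieldQuadraticLayerNoCapitulation.lean` (the injectivity of `Cl(M) → Cl(L)`), then `IwasawaTheory/ImaginaryQuadraticTwoTowerNoCapitulation.lean`.

SETTING.  `M ⊆ L` CM number fields, `[L : M] = 2`, `σ` the non-trivial `M`-automorphism of `L`, `c` complex conjugation.
* §1 `complexConj_algebraMap` (`c_L` restricts to `c_M`), `complexConj_algEquiv` (`σ c = c σ`), `algEquiv_eq_one_or_eq` / `exists_algEquiv_ne_one` /
  `mem_range_algebraMap_of_fixed` (`Gal(L/M) = {1, σ}`, `σ² = 1`, `L^σ = M`).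
* §2 `exists_rep_of_classGroupExtend_eq_one` (a capitulating class is `[𝔞]` with `𝔞𝓞_L = (α)`), `exists_unit_algEquiv_eq_mul` (`σα = α ε`, `ε` a unit),
  `unit_mul_algEquiv_unit_eq_one` (`ε σε = 1`), ★ `complexConj_unit_eq_self`: under (T) «`σ` fixes the roots of unity of `L`» and (NPI) «no unit with `ε̄ = −ε`»,
  **`ε̄ = ε`** (`θ = ε/ε̄` is a root of unity with `σθ = θ` and `σθ = θ⁻¹`, so `θ = ±1`, and `−1` is excluded).
* §3 ★ `exists_real_integer_algEquiv_eq_mul` — HILBERT 90 for the quadratic layer with a REAL INTEGRAL solution: for a real unit `ε` with `ε σε = 1` there is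
  `β ∈ 𝓞_L ∩ L⁺`, `β ≠ 0`, `σβ = εβ` (`β = 1 + ε⁻¹`, or, if `ε = −1`, `β = z + z̄` / `z·δ` with `z = x − σx`, `δ ∈ 𝓞_M` purely imaginary);
  `exists_integers_mul_eq_mul` (then `α/β ∈ M`: `α m₂ = m₁ β`).

References: [Ferrero1980AJM] §3; [Kida1979Tohoku]; [Washington1997] Thm. 10.3, Prop. 13.26; [NeukirchANT1999] Ch. IV §3 (3.5) (Hilbert 90), Ch. III §1 (1.6).
-/

set_option autoImplicit false

noncomputable section

open NumberField NumberField.IsCMField NumberField.Units IsDedekindDomain FractionalIdeal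
open scoped nonZeroDivisors Pointwise

namespace Literature.NumberTheory.NumberFields

open Literature.NumberTheory.NumberFields.AmbiguousClass Literature.NumberTheory.NumberFields.AmbiguousIdeal
  Literature.NumberTheory.Automorphic Literature.NumberTheory.GaloisRepresentations Literature.NumberTheory.GaloisRepresentations.Herbrand

namespace CMLayer

variable (M L : Type) [Field M] [NumberField M] [Field L] [NumberField L] [Algebra M L] [IsCMField M] [IsCMField L]

/-! ## §1 Complex conjugation on `M ⊆ L` and on `Gal(L/M)` -/

/-- **Complex conjugation of the CM field `L` restricts to that of the CM subfield `M`**: `c_L (x) = c_M (x)` for `x ∈ M` (both are THE complex conjugation under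
any complex embedding, Mathlib `IsCMField.complexEmbedding_complexConj`). [cite: Washington1997, §4 (before Thm. 4.12) / Thm. 10.3] -/
theorem complexConj_algebraMap (x : M) : complexConj L (algebraMap M L x) = algebraMap M L (complexConj M x) := by
  let φ : L →+* ℂ := Classical.choice (inferInstance : Nonempty (L →+* ℂ))
  apply φ.injective
  rw [complexEmbedding_complexConj L φ]
  have h := complexEmbedding_complexConj M (φ.comp (algebraMap M L)) x
  simp only [RingHom.comp_apply] at h
  rw [h]

omit [NumberField M] [IsCMField M] in
/-- **Every `M`-automorphism of `L` commutes with complex conjugation** (`φ ∘ σ` is another complex embedding). [cite: Washington1997, §4 (before Thm. 4.12: conjugation independent of the embedding for CM fields)] -/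
theorem complexConj_algEquiv (σ : L ≃ₐ[M] L) (x : L) : complexConj L (σ x) = σ (complexConj L x) := by
  let φ : L →+* ℂ := Classical.choice (inferInstance : Nonempty (L →+* ℂ))
  apply φ.injective
  have h1 := complexEmbedding_complexConj L φ (σ x)
  have h2 := complexEmbedding_complexConj L (φ.comp (σ : L →+* L)) x
  have h3 := complexEmbedding_complexConj L (φ.comp (σ : L →+* L)) (complexConj L x)
  simp only [RingHom.comp_apply, RingHom.coe_coe, complexConj_apply_apply] at h2 h3
  -- `h2 : φ (σ (c x)) = conj (φ (σ x))`
  rw [h1, ← h2]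

omit [NumberField M] [IsCMField M] in
/-- `σ` preserves the maximal real subfield `L⁺`. [cite: Washington1997, §4 (before Thm. 4.12)] -/
theorem algEquiv_mem_maximalRealSubfield (σ : L ≃ₐ[M] L) {x : L} (hx : x ∈ maximalRealSubfield L) : σ x ∈ maximalRealSubfield L := by
  rw [← complexConj_eq_self_iff] at hx ⊢
  rw [complexConj_algEquiv, hx]

omit [IsCMField M] [IsCMField L] in
/-- For `[L : M] = 2`: `Gal(L/M) = {1, σ}` for any `σ ≠ 1`, and `σ² = 1`. [cite: NeukirchANT1999, Ch. IV §1 (Galois extensions; a quadratic extension is cyclic of order 2)] -/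
theorem algEquiv_eq_one_or_eq (h2 : Module.finrank M L = 2) {σ : L ≃ₐ[M] L} (hσ : σ ≠ 1) (τ : L ≃ₐ[M] L) : τ = 1 ∨ τ = σ := by
  classical
  haveI : Module.Free M L := Module.Free.of_divisionRing M L
  haveI : Algebra.IsQuadraticExtension M L := { finrank_eq_two' := h2 }
  haveI : IsGalois M L := Algebra.IsQuadraticExtension.isGalois M L
  have hcard : Fintype.card (L ≃ₐ[M] L) = 2 := by rw [← Nat.card_eq_fintype_card, IsGalois.card_aut_eq_finrank, h2]
  by_contra h
  rw [not_or] at h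
  have h3 : Finset.card ({1, σ, τ} : Finset (L ≃ₐ[M] L)) = 3 := by
    rw [Finset.card_insert_of_notMem, Finset.card_pair (Ne.symm h.2)]
    simp only [Finset.mem_insert, Finset.mem_singleton, not_or]
    exact ⟨Ne.symm hσ, Ne.symm h.1⟩
  have := Finset.card_le_univ ({1, σ, τ} : Finset (L ≃ₐ[M] L))
  rw [h3, hcard] at this
  omega

omit [IsCMField M] [IsCMField L] in
/-- For `[L : M] = 2` there is a non-trivial `M`-automorphism of `L`, of order `2`. [cite: NeukirchANT1999, Ch. IV §1 (Galois extensions; a quadratic extension is cyclic of order 2)] -/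
theorem exists_algEquiv_ne_one (h2 : Module.finrank M L = 2) : ∃ σ : L ≃ₐ[M] L, σ ≠ 1 ∧ σ * σ = 1 := by
  classical
  haveI : Module.Free M L := Module.Free.of_divisionRing M L
  haveI : Algebra.IsQuadraticExtension M L := { finrank_eq_two' := h2 }
  haveI : IsGalois M L := Algebra.IsQuadraticExtension.isGalois M L
  have hcard : Fintype.card (L ≃ₐ[M] L) = 2 := by rw [← Nat.card_eq_fintype_card, IsGalois.card_aut_eq_finrank, h2]
  obtain ⟨σ, hσ⟩ := Fintype.exists_ne_of_one_lt_card (by rw [hcard]; norm_num) (1 : L ≃ₐ[M] L)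
  refine ⟨σ, hσ, ?_⟩
  have := pow_card_eq_one (G := L ≃ₐ[M] L) (x := σ)
  rwa [hcard, pow_two] at this

omit [IsCMField M] [IsCMField L] in
/-- For `[L : M] = 2` and `σ ≠ 1`: an element fixed by `σ` lies in `M` (Galois correspondence, `L^{Gal(L/M)} = M`). [cite: NeukirchANT1999, Ch. IV §1 (main theorem of Galois theory)] -/
theorem mem_range_algebraMap_of_fixed (h2 : Module.finrank M L = 2) {σ : L ≃ₐ[M] L} (hσ : σ ≠ 1) {x : L} (hx : σ x = x) :
    x ∈ Set.range (algebraMap M L) := by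
  haveI : Module.Free M L := Module.Free.of_divisionRing M L
  haveI : Algebra.IsQuadraticExtension M L := { finrank_eq_two' := h2 }
  haveI : IsGalois M L := Algebra.IsQuadraticExtension.isGalois M L
  rw [IsGalois.mem_range_algebraMap_iff_fixed]
  intro f
  rcases algEquiv_eq_one_or_eq M L h2 hσ f with rfl | rfl
  · rfl
  · exact hx

/-! ## §2 A capitulating ideal: generator, the unit `ε = σα/α`, reality of `ε` -/

omit [IsCMField M] [IsCMField L] in
/-- A capitulating class of `M` is represented by a non-zero ideal `𝔞` with `𝔞𝓞_L = (α)`, `α ≠ 0`. [cite: Washington1997, Thm. 10.3 (proof)] -/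
theorem exists_rep_of_classGroupExtend_eq_one {c : ClassGroup (𝓞 M)} (hc : classGroupExtend M L c = 1) :
    ∃ (𝔞 : Ideal (𝓞 M)) (h𝔞 : 𝔞 ≠ ⊥) (α : 𝓞 L), c = ClassGroup.mk0 ⟨𝔞, mem_nonZeroDivisors_of_ne_zero h𝔞⟩ ∧
      𝔞.map (algebraMap (𝓞 M) (𝓞 L)) = Ideal.span {α} ∧ α ≠ 0 := by
  obtain ⟨⟨𝔞, h𝔞⟩, rfl⟩ := ClassGroup.mk0_surjective c
  have h𝔞0 : 𝔞 ≠ ⊥ := nonZeroDivisors.ne_zero h𝔞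
  rw [classGroupExtend_mk0, ClassGroup.mk0_eq_one_iff] at hc
  obtain ⟨α, hα⟩ := hc
  have hα' : 𝔞.map (algebraMap (𝓞 M) (𝓞 L)) = Ideal.span {α} := hα
  refine ⟨𝔞, h𝔞0, α, rfl, hα', ?_⟩
  rintro rfl
  rw [Ideal.span_singleton_eq_bot.mpr rfl, Ideal.map_eq_bot_iff_of_injective (FaithfulSMul.algebraMap_injective _ _)] at hα'
  exact h𝔞0 hα'

omit [NumberField M] [NumberField L] [IsCMField M] [IsCMField L] in
/-- `σ ∈ Gal(L/M)` fixes the extension of an ideal of `M`: `σ(𝔞𝓞_L) = 𝔞𝓞_L`. [cite: NeukirchANT1999, Ch. III §1 Prop. (1.6) (iv) (extended ideals are Galois-invariant)] -/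
theorem map_intAut_map_eq (σ : L ≃ₐ[M] L) (𝔞 : Ideal (𝓞 M)) :
    (𝔞.map (algebraMap (𝓞 M) (𝓞 L))).map (intAut σ : 𝓞 L →+* 𝓞 L) = 𝔞.map (algebraMap (𝓞 M) (𝓞 L)) := by
  rw [Ideal.map_map]
  congr 1
  ext x
  change σ (algebraMap M L (x : M)) = algebraMap M L (x : M)
  exact σ.commutes (x : M)

omit [NumberField M] [NumberField L] [IsCMField M] [IsCMField L] in
/-- **`σα = α·ε` for a unit `ε`** when `𝔞𝓞_L = (α)` (`σ` permutes the generators of the `σ`-stable ideal `(α)`). [cite: Washington1997, Prop. 13.26 (proof)] -/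
theorem exists_unit_algEquiv_eq_mul (σ : L ≃ₐ[M] L) {𝔞 : Ideal (𝓞 M)} {α : 𝓞 L} (hα : 𝔞.map (algebraMap (𝓞 M) (𝓞 L)) = Ideal.span {α}) :
    ∃ u : (𝓞 L)ˣ, σ (α : L) = (α : L) * ((u : 𝓞 L) : L) := by
  have h := map_intAut_map_eq M L σ 𝔞
  rw [hα, Ideal.map_span, Set.image_singleton] at h
  obtain ⟨u, hu⟩ := Ideal.span_singleton_eq_span_singleton.mp h.symm
  refine ⟨u, ?_⟩
  have := congrArg (fun y : 𝓞 L => (y : L)) hu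
  simpa using this.symm

omit [NumberField M] [NumberField L] [IsCMField M] [IsCMField L] in
/-- `ε · σε = 1` for `ε = σα/α` when `σ² = 1` and `α ≠ 0`. [cite: Washington1997, Prop. 13.26 (proof)] -/
theorem unit_mul_algEquiv_unit_eq_one {σ : L ≃ₐ[M] L} (hσσ : σ * σ = 1) {α e : L} (hα : α ≠ 0) (he : σ α = α * e) : e * σ e = 1 := by
  have h1 : σ (σ α) = α := by rw [← AlgEquiv.mul_apply, hσσ, AlgEquiv.one_apply]
  rw [he, map_mul, he, mul_assoc] at h1
  have h2 : α * (e * σ e) = α * 1 := by rw [mul_one]; exact h1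
  exact mul_left_cancel₀ hα h2

omit [NumberField M] [IsCMField M] in
/-- **The unit `ε = σα/α` is REAL** under (T) and (NPI): `θ = ε/ε̄` is a root of unity with `σθ = θ` (T) and `σθ = θ⁻¹` (`σε = ε⁻¹`, `σ` commutes with `c`), so
`θ = ±1`, and `θ = −1` would make `ε` purely imaginary (NPI). [cite: Ferrero1980AJM, §3] [cite: Washington1997, Thm. 10.3 (proof)] -/
theorem complexConj_unit_eq_self (σ : L ≃ₐ[M] L)
    (hT : ∀ (x : L) (n : ℕ), 0 < n → x ^ n = 1 → σ x = x)
    (hNPI : ∀ u : (𝓞 L)ˣ, complexConj L ((u : 𝓞 L) : L) ≠ -((u : 𝓞 L) : L))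
    (u : (𝓞 L)ˣ) (hu : ((u : 𝓞 L) : L) * σ ((u : 𝓞 L) : L) = 1) :
    complexConj L ((u : 𝓞 L) : L) = ((u : 𝓞 L) : L) := by
  set e : L := ((u : 𝓞 L) : L) with he
  have he0 : e ≠ 0 := by
    rw [he]; exact_mod_cast (Units.ne_zero u)
  set eb : L := complexConj L e with heb
  have heb0 : eb ≠ 0 := (_root_.map_ne_zero _).mpr he0
  -- `θ = e / ē` is a root of unity (a unit of absolute value `1` everywhere)
  set θu : (𝓞 L)ˣ := (unitsMulComplexConjInv L u : (𝓞 L)ˣ) with hθu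
  have hθval : ((θu : 𝓞 L) : L) = e * eb⁻¹ := by
    have h1 : θu * unitsComplexConj L u = u := by rw [hθu, unitsMulComplexConjInv_apply, inv_mul_cancel_right]
    have h2 := congrArg (fun t : (𝓞 L)ˣ => ((t : 𝓞 L) : L)) h1
    simp only [Units.val_mul] at h2
    push_cast at h2
    change ((θu : 𝓞 L) : L) * eb = e at h2
    exact (eq_mul_inv_iff_mul_eq₀ heb0).mpr h2
  have hfin : IsOfFinOrder θu := (CommGroup.mem_torsion _).mp (unitsMulComplexConjInv L u).2
  obtain ⟨n, hn, hθn⟩ := hfin.exists_pow_eq_one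
  have hθn' : (e * eb⁻¹) ^ n = 1 := by
    rw [← hθval]
    have := congrArg (fun t : (𝓞 L)ˣ => ((t : 𝓞 L) : L)) hθn
    simp only [Units.val_pow_eq_pow_val, Units.val_one] at this
    push_cast at this
    exact this
  -- `σ θ = θ` by (T), and `σ θ = θ⁻¹`
  have hσe : σ e = e⁻¹ := eq_inv_of_mul_eq_one_right hu
  have hσθ : σ (e * eb⁻¹) = (e * eb⁻¹)⁻¹ := by
    rw [map_mul, map_inv₀, heb, ← complexConj_algEquiv M L σ e, hσe, map_inv₀, mul_inv, inv_inv, mul_comm]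
  have hfix := hT (e * eb⁻¹) n hn hθn'
  rw [hσθ] at hfix
  -- so `θ² = 1`
  have hθ0 : e * eb⁻¹ ≠ 0 := mul_ne_zero he0 (inv_ne_zero heb0)
  have hsq : (e * eb⁻¹) * (e * eb⁻¹) = 1 := by
    have := congrArg (fun t => t * (e * eb⁻¹)) hfix
    simp only [inv_mul_cancel₀ hθ0] at this
    exact this.symm
  rcases mul_self_eq_one_iff.mp hsq with h1 | h1
  · -- `e = ē`
    have : e = eb := by
      have := congrArg (fun t => t * eb) h1
      simpa [mul_assoc, inv_mul_cancel₀ heb0] using this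
    exact this.symm
  · -- `e = −ē`: purely imaginary, excluded
    exfalso
    have : e = -eb := by
      have := congrArg (fun t => t * eb) h1
      simpa [mul_assoc, inv_mul_cancel₀ heb0] using this
    refine hNPI u ?_
    change eb = -e
    rw [this, neg_neg]

/-! ## §3 Hilbert 90 for the quadratic layer, explicitly, with a REAL solution -/

omit [NumberField M] [IsCMField M] [IsCMField L] in
/-- For `σ ≠ 1` there is an algebraic integer of `L` moved by `σ` (`L = Frac 𝓞_L`). [cite: NeukirchANT1999, Ch. I §2 (`K` is the field of fractions of `𝓞_K`)] -/
theorem exists_integer_algEquiv_ne {σ : L ≃ₐ[M] L} (hσ : σ ≠ 1) : ∃ x : 𝓞 L, σ (x : L) ≠ (x : L) := by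
  by_contra h
  push Not at h
  apply hσ
  ext y
  obtain ⟨a, b, hb, rfl⟩ := IsFractionRing.div_surjective (A := 𝓞 L) y
  rw [AlgEquiv.one_apply, map_div₀, h a, h b]

/-- A CM field has a non-zero purely imaginary algebraic integer `δ` (`δ̄ = −δ`: `δ = x − x̄` for an integer `x ∉ M⁺`). [cite: Washington1997, §4 (before Thm. 4.12: `K = K⁺(√-d)`-type generators of CM fields)] -/
theorem exists_integer_complexConj_eq_neg : ∃ δ : 𝓞 M, (δ : M) ≠ 0 ∧ complexConj M (δ : M) = -(δ : M) := by
  have hne : complexConj M ≠ 1 := complexConj_ne_one M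
  obtain ⟨x, hx⟩ : ∃ x : 𝓞 M, complexConj M (x : M) ≠ (x : M) := by
    by_contra h
    push Not at h
    apply hne
    ext y
    obtain ⟨a, b, hb, rfl⟩ := IsFractionRing.div_surjective (A := 𝓞 M) y
    rw [AlgEquiv.one_apply, map_div₀, h a, h b]
  refine ⟨x - ringOfIntegersComplexConj M x, ?_, ?_⟩
  · intro h0
    apply hx
    have : (x : M) - complexConj M (x : M) = 0 := by simpa using h0
    exact (sub_eq_zero.mp this).symm
  · simp [map_sub, complexConj_apply_apply]

/-- **Hilbert 90 for `L/M` quadratic, with a REAL integral solution**: for a real unit `ε` with `ε·σε = 1` there is `β ∈ 𝓞_L ∩ L⁺`, `β ≠ 0`, with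
`σβ = εβ` (`β = 1 + ε⁻¹` unless `ε = −1`; then `β = z + z̄` or `z·δ` for `z = x − σx`). [cite: NeukirchANT1999, Ch. IV §3 Thm. (3.5) (Hilbert 90)] -/
theorem exists_real_integer_algEquiv_eq_mul {σ : L ≃ₐ[M] L} (hσ : σ ≠ 1) (hσσ : σ * σ = 1) (u : (𝓞 L)ˣ)
    (hu : ((u : 𝓞 L) : L) * σ ((u : 𝓞 L) : L) = 1) (hreal : complexConj L ((u : 𝓞 L) : L) = ((u : 𝓞 L) : L)) :
    ∃ β : 𝓞 L, (β : L) ≠ 0 ∧ complexConj L (β : L) = (β : L) ∧ σ (β : L) = ((u : 𝓞 L) : L) * (β : L) := by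
  set e : L := ((u : 𝓞 L) : L) with he
  have he0 : e ≠ 0 := by rw [he]; exact_mod_cast (Units.ne_zero u)
  have hσe : σ e = e⁻¹ := eq_inv_of_mul_eq_one_right hu
  have hui : (((u⁻¹ : (𝓞 L)ˣ) : 𝓞 L) : L) = e⁻¹ := by
    apply eq_inv_of_mul_eq_one_left
    have := congrArg (fun t : (𝓞 L)ˣ => ((t : 𝓞 L) : L)) (inv_mul_cancel u)
    simp only [Units.val_mul, Units.val_one] at this
    push_cast at this
    exact this
  have hval1 : (((1 + ((u⁻¹ : (𝓞 L)ˣ) : 𝓞 L) : 𝓞 L)) : L) = 1 + e⁻¹ := by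
    rw [← hui]; push_cast; rfl
  by_cases hne : e ≠ -1
  · -- `β = 1 + ε⁻¹`
    refine ⟨1 + ((u⁻¹ : (𝓞 L)ˣ) : 𝓞 L), ?_, ?_, ?_⟩
    · rw [hval1]
      intro h0
      apply hne
      have h1 : e⁻¹ = -1 := by linear_combination h0
      rw [← inv_inv e, h1, inv_neg, inv_one]
    · rw [hval1, map_add, map_one, map_inv₀, hreal]
    · rw [hval1, map_add, map_one, map_inv₀, hσe, inv_inv, mul_add, mul_one, mul_inv_cancel₀ he0, add_comm]
  · -- `ε = −1`
    rw [not_ne_iff] at hne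
    obtain ⟨x, hx⟩ := exists_integer_algEquiv_ne M L hσ
    set z : 𝓞 L := x - intAut σ x with hz
    have hzval : (z : L) = (x : L) - σ (x : L) := by simp [hz]
    have hz0 : (z : L) ≠ 0 := by rw [hzval]; exact sub_ne_zero.mpr (Ne.symm hx)
    have hσz : σ (z : L) = -(z : L) := by
      rw [hzval, map_sub, ← AlgEquiv.mul_apply, hσσ, AlgEquiv.one_apply]; ring
    by_cases hsum : (z : L) + complexConj L (z : L) ≠ 0
    · refine ⟨z + ringOfIntegersComplexConj L z, ?_, ?_, ?_⟩
      · simpa using hsum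
      · simp [map_add, complexConj_apply_apply, add_comm]
      · have hval : (((z + ringOfIntegersComplexConj L z : 𝓞 L)) : L) = (z : L) + complexConj L (z : L) := by simp
        rw [hval, map_add, ← complexConj_algEquiv M L σ, hσz, map_neg, hne]; ring
    · rw [not_ne_iff] at hsum
      have hzbar : complexConj L (z : L) = -(z : L) := by linear_combination hsum
      obtain ⟨δ, hδ0, hδ⟩ := exists_integer_complexConj_eq_neg M
      refine ⟨z * algebraMap (𝓞 M) (𝓞 L) δ, ?_, ?_, ?_⟩
      · have hval : ((z * algebraMap (𝓞 M) (𝓞 L) δ : 𝓞 L) : L) = (z : L) * algebraMap M L (δ : M) := by push_cast; rfl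
        rw [hval]
        exact mul_ne_zero hz0 ((_root_.map_ne_zero _).mpr hδ0)
      · have hval : ((z * algebraMap (𝓞 M) (𝓞 L) δ : 𝓞 L) : L) = (z : L) * algebraMap M L (δ : M) := by push_cast; rfl
        rw [hval, map_mul, hzbar, complexConj_algebraMap M L, hδ, map_neg]; ring
      · have hval : ((z * algebraMap (𝓞 M) (𝓞 L) δ : 𝓞 L) : L) = (z : L) * algebraMap M L (δ : M) := by push_cast; rfl
        rw [hval, map_mul, hσz, AlgEquiv.commutes, hne]; ring

omit [IsCMField M] [IsCMField L] in
/-- **Descent of the generator**: if `σα = εα` and `σβ = εβ` with `β ≠ 0` then `α/β ∈ M`: `α·m₂ = m₁·β` with `m₁, m₂ ∈ 𝓞_M`, `m₂ ≠ 0`.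
[cite: Washington1997, Thm. 10.3 (proof)] -/
theorem exists_integers_mul_eq_mul (h2 : Module.finrank M L = 2) {σ : L ≃ₐ[M] L} (hσ : σ ≠ 1) {α β e : L} (hβ : β ≠ 0)
    (hα : σ α = α * e) (hβσ : σ β = e * β) :
    ∃ m₁ m₂ : 𝓞 M, (m₂ : M) ≠ 0 ∧ α * algebraMap M L (m₂ : M) = algebraMap M L (m₁ : M) * β := by
  have he0 : e ≠ 0 := by
    intro h0
    rw [h0, zero_mul] at hβσ
    exact hβ (by simpa using hβσ)
  have hfix : σ (α / β) = α / β := by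
    rw [map_div₀, hα, hβσ, mul_comm e β, mul_div_mul_right _ _ he0]
  obtain ⟨m, hm⟩ := mem_range_algebraMap_of_fixed M L h2 hσ hfix
  obtain ⟨m₁, m₂, hm₂, rfl⟩ := IsFractionRing.div_surjective (A := 𝓞 M) m
  refine ⟨m₁, m₂, ?_, ?_⟩
  · exact_mod_cast nonZeroDivisors.ne_zero hm₂
  · rw [map_div₀] at hm
    have hm₂' : algebraMap M L (m₂ : M) ≠ 0 := (_root_.map_ne_zero _).mpr (by exact_mod_cast nonZeroDivisors.ne_zero hm₂)
    field_simp at hm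
    -- hm : algebraMap m₁ * β = algebraMap m₂ * α
    have hm' : algebraMap M L (m₁ : M) * β = algebraMap M L (m₂ : M) * α := hm
    linear_combination -hm'

end CMLayer

end Literature.NumberTheory.NumberFields

end
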